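import Literature.Analysis.FluidPDE.DuchonRobertSymmTestFieldAdmissible
import HarnessLib

/-!
# Duchon–Robert's exact time pairing for the regularised symmetric test field: proof of (E2)

Analysis/FluidPDE proof file: the discharge `Torus.drTestApprox_timePairing_holds` of the named
step fact (E2) `Torus.drTestApprox_timePairing` of `FluidPDE/DuchonRobertSymmTestField`
(Duchon–Robert 2000, proof of Prop. 1, p. 250: multiplying the Navier–Stokes equation for `u` by
`u^ε`, the regularised equation by `u`, and adding produces `∂ₜ(u·u^ε)`). For the regularised
symmetric field `Φ = S[ψ·Aw + A(ψw)]`, `S = (ρ ⊗ k) ⋆` (`Torus.stConv`, even `ρ = φ.normed`,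
`k = Torus.kernel ε`), `A = ⋆ₓK` (`K` even), `w = Sū`:

  `∫₀ᵀ∫ ⟪u, ∂ₜΦ⟫ = ∫₀ᵀ∫ ⟪w, w ⋆ K⟫ ∂ₜψ`.

## The proof

* `(Sū)(s) ⋆ K = (ρ ⊗ (k ⋆ K)) ⋆ ū (s)` (`Torus.convolution_stConv_apply`, Fubini and translation
  invariance), so `v := Aw` and `∂ₜv` are again space–time mollifications of `ū`, with
  `∂ₜw = (ρ' ⊗ k) ⋆ ū`, `∂ₜv = (ρ' ⊗ (k⋆K)) ⋆ ū` (the tree's `hasDerivAt_stConv_time`,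
  `timeDeriv_stConv`);
* on `ℝ × T^d` with `ū = Torus.stBar T u`: `∫₀ᵀ∫ ⟪u, ∂ₜΦ⟫ = ∑ⱼ ∫ ūⱼ · (ρ' ⊗ k) ⋆ Gⱼ`
  (`Gⱼ = ψ vⱼ + (ψwⱼ) ⋆ K` the inner field), and by duality with the odd kernel `ρ'`
  (`integral_mul_stConv_odd_even`) this is `-∑ⱼ ∫ Gⱼ ∂ₜwⱼ`;
* `∫ Gⱼ ∂ₜwⱼ = ∫ ψ (vⱼ ∂ₜwⱼ + wⱼ ∂ₜvⱼ)`: the second piece of `Gⱼ` is moved across `⋆K` slice by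
  slice (`Torus.integral_mul_convolution_comm`, `K` even) and `(∂ₜwⱼ)(s) ⋆ K = ∂ₜvⱼ(s)`;
* summing over `j`, `∑ⱼ(vⱼ∂ₜwⱼ + wⱼ∂ₜvⱼ) = ∂ₜ(w·v)` pointwise, and an integration by parts in time
  for every fixed `x` (Mathlib's `integral_mul_deriv_eq_deriv_mul_of_integrable`, `ψ(·, x)`
  compactly supported) gives `-∫∫ ψ ∂ₜ(w·v) = ∫∫ ∂ₜψ (w·v)`, which is the right-hand side
  (`⟪w, w ⋆ K⟫ = w·v`; `∂ₜψ` vanishes off `(0, T)`, `Torus.timeDeriv_eq_zero_of_support`).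

All integrands are bounded, jointly measurable and supported in `supp_t ψ × T^d`
(`Torus.integrable_of_bdd_of_time_support`).

## References

* J. Duchon, R. Robert, Nonlinearity 13 (2000), proof of Prop. 1 (p. 250). [DuchonRobert2000]
* A. Cheskidov, P. Constantin, S. Friedlander, R. Shvydkoy, Nonlinearity 21 (2008), §3.1–3.2
  (the same computation for the CCFS energy balance, tree: `FluidPDE/OnsagerCCFSTestField`). [CCFS2008]
-/

noncomputable section

open MeasureTheory Set Filter Topology Function UnitAddTorus
open scoped ENNReal NNReal Convolution ContDiff InnerProductSpace

namespace Literature.Analysis.FluidPDE.Torus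

open Literature.Analysis.FunctionSpaces

variable {d : Type*} [Fintype d] [DecidableEq d]

/-! ## Tools for the exact time pairing -/

section PairingTools

variable {F : ℝ × UnitAddTorus d → ℝ} {ρ : ℝ → ℝ} {k K : UnitAddTorus d → ℝ}

omit [DecidableEq d] in
/-- A bounded, jointly measurable function on `ℝ × T^d` vanishing off `[a, b] × T^d` is integrable. [folklore] -/
theorem integrable_of_bdd_of_time_support {f : ℝ × UnitAddTorus d → ℝ}
    (hf : AEStronglyMeasurable f ((volume : Measure ℝ).prod volume)) {M : ℝ} (hM : ∀ q, ‖f q‖ ≤ M)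
    {a b : ℝ} (hab : ∀ q : ℝ × UnitAddTorus d, q.1 ∉ Icc a b → f q = 0) :
    Integrable f ((volume : Measure ℝ).prod volume) := by
  set μ : Measure (ℝ × UnitAddTorus d) := (volume : Measure ℝ).prod volume with hμ
  have hdom : Integrable (fun q : ℝ × UnitAddTorus d => (Icc a b ×ˢ (univ : Set (UnitAddTorus d))).indicator
      (fun _ => M) q) μ := by
    refine (integrable_indicator_iff (measurableSet_Icc.prod MeasurableSet.univ)).2 (integrableOn_const ?_)
    rw [hμ, Measure.prod_prod, measure_univ, mul_one, Real.volume_Icc]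
    exact ENNReal.ofReal_ne_top
  refine hdom.mono' hf (ae_of_all _ fun q => ?_)
  by_cases hq : q.1 ∈ Icc a b
  · rw [indicator_of_mem (show q ∈ Icc a b ×ˢ (univ : Set (UnitAddTorus d)) from ⟨hq, mem_univ _⟩)]
    exact hM q
  · rw [hab q hq, norm_zero, indicator_apply]
    split_ifs
    · exact (norm_nonneg _).trans (hM q)
    · exact le_rfl

omit [DecidableEq d] in
/-- **Associativity of space mollification with a space–time mollification**:
`(stConv ρ k F)(s) ⋆ K = stConv ρ (k ⋆ K) F (s)` (Fubini on `T^d × (ℝ × T^d)` and translation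
invariance of the Haar integral). [folklore] -/
theorem convolution_stConv_apply (hF : Integrable F ((volume : Measure ℝ).prod volume))
    (hρ : Continuous ρ) (hρc : HasCompactSupport ρ) (hk : Continuous k) (hK : Continuous K)
    (s : ℝ) (x : UnitAddTorus d) :
    ((FunctionSpaces.Torus.stConv ρ k F s) ⋆ K) x = FunctionSpaces.Torus.stConv ρ (k ⋆ K) F s x := by
  set μ : Measure (ℝ × UnitAddTorus d) := (volume : Measure ℝ).prod volume with hμ
  obtain ⟨A, hA⟩ := hρ.bounded_above_of_compact_support hρc
  obtain ⟨B, hB⟩ := FunctionSpaces.Torus.exists_forall_norm_le_of_continuous hk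
  obtain ⟨B', hB'⟩ := FunctionSpaces.Torus.exists_forall_norm_le_of_continuous hK
  -- the integrand, variables `(y, p) ∈ T^d × (ℝ × T^d)`
  set Φ : UnitAddTorus d → (ℝ × UnitAddTorus d) → ℝ :=
    fun y p => F p * (ρ (s - p.1) * k (y - p.2)) * K (x - y) with hΦ
  have hΦi : Integrable (uncurry Φ) ((volume : Measure (UnitAddTorus d)).prod μ) := by
    have hFm : AEStronglyMeasurable (fun w : UnitAddTorus d × (ℝ × UnitAddTorus d) => F w.2)
        ((volume : Measure (UnitAddTorus d)).prod μ) :=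
      hF.1.comp_quasiMeasurePreserving Measure.quasiMeasurePreserving_snd
    have hc : Continuous fun w : UnitAddTorus d × (ℝ × UnitAddTorus d) =>
        (ρ (s - w.2.1) * k (w.1 - w.2.2)) * K (x - w.1) := by fun_prop
    have hm : AEStronglyMeasurable (uncurry Φ) ((volume : Measure (UnitAddTorus d)).prod μ) :=
      ((hFm.mul hc.aestronglyMeasurable)).congr (ae_of_all _ fun w => by simp only [hΦ, uncurry, Pi.mul_apply]; ring)
    have hdom : Integrable (fun w : UnitAddTorus d × (ℝ × UnitAddTorus d) => (A * B * B') * ‖F w.2‖)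
        ((volume : Measure (UnitAddTorus d)).prod μ) :=
      (integrable_const (A * B * B')).mul_prod hF.norm
    refine hdom.mono' hm (ae_of_all _ fun w => ?_)
    simp only [hΦ, uncurry, norm_mul]
    have h0 : 0 ≤ A := (norm_nonneg _).trans (hA 0)
    have h0B : 0 ≤ B := (norm_nonneg _).trans (hB 0)
    have h1 : ‖ρ (s - w.2.1)‖ * ‖k (w.1 - w.2.2)‖ ≤ A * B := mul_le_mul (hA _) (hB _) (norm_nonneg _) h0
    calc ‖F w.2‖ * (‖ρ (s - w.2.1)‖ * ‖k (w.1 - w.2.2)‖) * ‖K (x - w.1)‖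
        ≤ ‖F w.2‖ * (A * B) * B' :=
          mul_le_mul (mul_le_mul_of_nonneg_left h1 (norm_nonneg _)) (hB' _) (norm_nonneg _)
            (mul_nonneg (norm_nonneg _) (mul_nonneg h0 h0B))
      _ = A * B * B' * ‖F w.2‖ := by ring
  calc ((FunctionSpaces.Torus.stConv ρ k F s) ⋆ K) x = ∫ y, ∫ p, Φ y p ∂μ := by
        rw [convolution_lsmul]
        refine integral_congr_ae (ae_of_all _ fun y => ?_)
        simp only [FunctionSpaces.Torus.stConv, smul_eq_mul, hΦ, hμ, ← integral_mul_const]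
    _ = ∫ p, (∫ y, Φ y p) ∂μ := integral_integral_swap hΦi
    _ = FunctionSpaces.Torus.stConv ρ (k ⋆ K) F s x := by
        simp only [FunctionSpaces.Torus.stConv, hμ]
        refine integral_congr_ae (ae_of_all _ fun p => ?_)
        simp only [hΦ]
        have e : ∫ y, F p * (ρ (s - p.1) * k (y - p.2)) * K (x - y) =
            F p * ρ (s - p.1) * ∫ y, k (y - p.2) * K (x - y) := by
          rw [← integral_const_mul]
          refine integral_congr_ae (ae_of_all _ fun y => ?_); ring
        rw [e, convolution_lsmul]
        have e2 : ∫ y, k (y - p.2) * K (x - y) = ∫ t, k t * K (x - p.2 - t) := by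
          rw [← integral_sub_right_eq_self (fun t => k t * K (x - p.2 - t)) p.2]
          refine integral_congr_ae (ae_of_all _ fun y => ?_)
          show k (y - p.2) * K (x - y) = k (y - p.2) * K (x - p.2 - (y - p.2))
          congr 2; abel
        rw [e2]
        simp only [smul_eq_mul]
        ring

omit [DecidableEq d] in
/-- The time derivative of a field with smooth space–time lift has smooth space–time lift (twin of
`Torus.contDiff_stLift_timeDeriv` of `FluidPDE/DuchonRobertPressure`, not imported here). [folklore] -/
theorem contDiff_stLift_timeDeriv' {G : Type*} [NormedAddCommGroup G] [NormedSpace ℝ G]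
    {φ : ℝ → UnitAddTorus d → G} (hφ : ContDiff ℝ ∞ (FunctionSpaces.Torus.stLift φ)) :
    ContDiff ℝ ∞ (FunctionSpaces.Torus.stLift (FunctionSpaces.Torus.timeDeriv φ)) := by
  rw [FunctionSpaces.Torus.stLift_timeDeriv]
  refine ContDiff.fderiv_apply (m := ∞)
    (f := fun (p : ℝ × EuclideanSpace ℝ d) (τ : ℝ) => FunctionSpaces.Torus.stLift φ (τ, p.2)) ?_ contDiff_fst
    contDiff_const (le_of_eq rfl)
  exact hφ.comp (contDiff_snd.prodMk (contDiff_snd.comp contDiff_fst))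

omit [DecidableEq d] in
/-- Time slices `s ↦ φ s x` of a field with smooth space–time lift are differentiable (twin of
`Torus.differentiableAt_time_slice` of `FluidPDE/DuchonRobertPressure`). [folklore] -/
theorem differentiableAt_time_slice' {G : Type*} [NormedAddCommGroup G] [NormedSpace ℝ G]
    {φ : ℝ → UnitAddTorus d → G} (hφ : ContDiff ℝ ∞ (FunctionSpaces.Torus.stLift φ))
    (t : ℝ) (x : UnitAddTorus d) : DifferentiableAt ℝ (fun s => φ s x) t := by
  obtain ⟨y, rfl⟩ := FunctionSpaces.Torus.proj_surjective x
  have h : (fun s => φ s (FunctionSpaces.Torus.proj y)) = FunctionSpaces.Torus.stLift φ ∘ fun s : ℝ => (s, y) := by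
    funext s; rfl
  rw [h]
  exact ((hφ.differentiable (by simp)).comp ((contDiff_prodMk_left y (n := ∞)).differentiable (by simp))).differentiableAt

omit [Fintype d] [DecidableEq d] in
/-- The derivative of a differentiable function vanishing on `(-∞, t₀]` vanishes on `(-∞, t₀]`. [folklore] -/
theorem deriv_eq_zero_of_forall_le_eq_zero {G : Type*} [NormedAddCommGroup G] [NormedSpace ℝ G]
    {f : ℝ → G} (hf : Differentiable ℝ f) {t₀ : ℝ} (h : ∀ s ≤ t₀, f s = 0) {t : ℝ} (ht : t ≤ t₀) :
    deriv f t = 0 := by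
  rcases lt_or_eq_of_le ht with ht' | rfl
  · have he : f =ᶠ[𝓝 t] fun _ => 0 := by
      filter_upwards [Iio_mem_nhds ht'] with s hs using h s hs.le
    rw [he.deriv_eq, deriv_const]
  · rw [← (hf t).derivWithin (uniqueDiffWithinAt_Iic t)]
    have he : EqOn f (fun _ => 0) (Iic t) := fun s hs => h s hs
    rw [derivWithin_congr he (h t le_rfl)]
    simp

omit [Fintype d] [DecidableEq d] in
/-- The derivative of a differentiable function vanishing on `[t₀, ∞)` vanishes on `[t₀, ∞)`. [folklore] -/
theorem deriv_eq_zero_of_forall_ge_eq_zero {G : Type*} [NormedAddCommGroup G] [NormedSpace ℝ G]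
    {f : ℝ → G} (hf : Differentiable ℝ f) {t₀ : ℝ} (h : ∀ s, t₀ ≤ s → f s = 0) {t : ℝ} (ht : t₀ ≤ t) :
    deriv f t = 0 := by
  rcases lt_or_eq_of_le ht with ht' | rfl
  · have he : f =ᶠ[𝓝 t] fun _ => 0 := by
      filter_upwards [Ioi_mem_nhds ht'] with s hs using h s hs.le
    rw [he.deriv_eq, deriv_const]
  · rw [← (hf _).derivWithin (uniqueDiffWithinAt_Ici _)]
    have he : EqOn f (fun _ => 0) (Ici t₀) := fun s hs => h s hs
    rw [derivWithin_congr he (h _ le_rfl)]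
    simp

omit [DecidableEq d] in
/-- The time derivative of a test function supported in `(0,T)` vanishes off the open time support:
if `ψ(s) = 0` for `s ≤ ε₀` and for `s ≥ T'`, then `∂ₜψ(t) = 0` for `t ≤ ε₀` and for `t ≥ T'`. [folklore] -/
theorem timeDeriv_eq_zero_of_support {ψ : ℝ → UnitAddTorus d → ℝ} (hψ : ContDiff ℝ ∞ (FunctionSpaces.Torus.stLift ψ))
    {ε₀ T' : ℝ} (h0 : ∀ s ≤ ε₀, ψ s = 0) (hT : ∀ s, T' ≤ s → ψ s = 0) {t : ℝ} (ht : t ≤ ε₀ ∨ T' ≤ t)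
    (x : UnitAddTorus d) : FunctionSpaces.Torus.timeDeriv ψ t x = 0 := by
  have hd : Differentiable ℝ fun s => ψ s x := fun s => differentiableAt_time_slice' hψ s x
  rw [FunctionSpaces.Torus.timeDeriv]
  rcases ht with ht | ht
  · exact deriv_eq_zero_of_forall_le_eq_zero hd (fun s hs => by rw [h0 s hs]; rfl) ht
  · exact deriv_eq_zero_of_forall_ge_eq_zero hd (fun s hs => by rw [hT s hs]; rfl) ht

end PairingTools

/-! ## The exact time pairing: proof of (E2) -/

section Pairing

omit [DecidableEq d] in
set_option maxHeartbeats 1600000 in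
/-- **Discharge of (E2)**: the time-derivative pairing of `u` with the regularised symmetric field
is exact, `∫₀ᵀ∫ ⟪u, ∂ₜΦ⟫ = ∫₀ᵀ∫ ⟪w, w ⋆ K⟫ ∂ₜψ` (Duchon–Robert 2000, proof of Prop. 1, p. 250:
"(NS)·u^ε + (NS^ε)·u" yields `∂ₜ(u·u^ε)`). With `S = (ρ ⊗ k) ⋆`, `A = ⋆ₓK`, `w = Sū`, `v = Aw = (ρ ⊗ (k⋆K)) ⋆ ū`:
`⟨ū, ∂ₜS G⟩ = -⟨G, ∂ₜw⟩` componentwise by duality with the odd kernel `ρ'` (`integral_mul_stConv_odd_even`,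
`timeDeriv_stConv`), and `⟨G, ∂ₜw⟩ = ∫∫ψ (v ∂ₜw + w ∂ₜv)` by adjointness of `A` on each slice
(`integral_mul_convolution_comm`, `K` even; `(Sū)(s) ⋆ K = (ρ ⊗ (k⋆K)) ⋆ ū (s)`), so that
`⟨ū, ∂ₜΦ⟩ = -∫∫ ψ ∂ₜ(w·v) = ∫∫ ∂ₜψ (w·v)` after an integration by parts in time. [cite: DuchonRobert2000, proof of Prop. 1 p. 250] -/
theorem drTestApprox_timePairing_holds : drTestApprox_timePairing (d := d) := by
  intro T u hmeas hu2 φ ε hε hε' K hK hKev ψ hψ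
  set μ : Measure (ℝ × UnitAddTorus d) := (volume : Measure ℝ).prod volume with hμ
  set ρ : ℝ → ℝ := φ.normed volume with hρ
  set k : UnitAddTorus d → ℝ := FunctionSpaces.Torus.kernel ε with hk
  have hρs : ContDiff ℝ ∞ ρ := φ.contDiff_normed
  have hρc : HasCompactSupport ρ := φ.hasCompactSupport_normed
  have hρeven : ∀ r, ρ (-r) = ρ r := fun r => φ.normed_neg r
  have hρ1 : ContDiff ℝ 1 ρ := hρs.of_le (by norm_cast)
  have hρ's : ContDiff ℝ ∞ (deriv ρ) := hρs.deriv'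
  have hρ'c : HasCompactSupport (deriv ρ) := hρc.deriv
  have hρ'odd : ∀ r, deriv ρ (-r) = -deriv ρ r := FunctionSpaces.deriv_neg_of_even hρeven
  have hks : FunctionSpaces.Torus.IsSmooth k := FunctionSpaces.Torus.isSmooth_kernel hε hε'
  have hk1 : FunctionSpaces.Torus.IsContDiff 1 k := hks.isContDiff (by simp)
  have hkev : ∀ z, k (-z) = k z := FunctionSpaces.Torus.kernel_neg hε hε'
  set k' : UnitAddTorus d → ℝ := k ⋆ K with hk'
  have hk's : FunctionSpaces.Torus.IsSmooth k' := FunctionSpaces.Torus.isSmooth_convolution hks.integrable hK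
  have hk'1 : FunctionSpaces.Torus.IsContDiff 1 k' := hk's.isContDiff (by simp)
  -- the extended velocity and its components
  have hm : AEStronglyMeasurable (uncurry u) ((volume.restrict (Ioo 0 T)).prod volume) :=
    aestronglyMeasurable_uncurry_prod_of_stLift_Ioo hmeas
  set U : ℝ × UnitAddTorus d → EuclideanSpace ℝ d := stBar T u with hU
  have hbar1 : Integrable U μ := integrable_stBar hm hu2
  have hU1 : ∀ j, Integrable (fun q => U q j) μ := fun j => (EuclideanSpace.proj (𝕜 := ℝ) j).integrable_comp hbar1
  -- the regularised fields and their time derivatives, componentwise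
  set w : d → ℝ → UnitAddTorus d → ℝ := fun j => FunctionSpaces.Torus.stConv ρ k fun q => U q j with hw
  set w' : d → ℝ → UnitAddTorus d → ℝ := fun j => FunctionSpaces.Torus.stConv (deriv ρ) k fun q => U q j with hw'
  set v : d → ℝ → UnitAddTorus d → ℝ := fun j => FunctionSpaces.Torus.stConv ρ k' fun q => U q j with hv
  set v' : d → ℝ → UnitAddTorus d → ℝ := fun j => FunctionSpaces.Torus.stConv (deriv ρ) k' fun q => U q j with hv'
  have hwvel : ∀ t x j, drVelocityApprox T u ρ k t x j = w j t x := fun t x j => rfl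
  -- smoothness, continuity, bounds
  have hsm : ∀ {η : ℝ → ℝ} {κ : UnitAddTorus d → ℝ}, ContDiff ℝ ∞ η → HasCompactSupport η → FunctionSpaces.Torus.IsSmooth κ →
      ∀ j, ContDiff ℝ ∞ (FunctionSpaces.Torus.stLift (FunctionSpaces.Torus.stConv η κ fun q => U q j)) :=
    fun hη hηc hκ j => FunctionSpaces.Torus.contDiff_top_stLift_stConv (hU1 j) hη hηc hκ
  have hw_s : ∀ j, ContDiff ℝ ∞ (FunctionSpaces.Torus.stLift (w j)) := hsm hρs hρc hks
  have hw'_s : ∀ j, ContDiff ℝ ∞ (FunctionSpaces.Torus.stLift (w' j)) := hsm hρ's hρ'c hks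
  have hv_s : ∀ j, ContDiff ℝ ∞ (FunctionSpaces.Torus.stLift (v j)) := hsm hρs hρc hk's
  have hv'_s : ∀ j, ContDiff ℝ ∞ (FunctionSpaces.Torus.stLift (v' j)) := hsm hρ's hρ'c hk's
  have hcont : ∀ {g : ℝ → UnitAddTorus d → ℝ}, ContDiff ℝ ∞ (FunctionSpaces.Torus.stLift g) → Continuous (uncurry g) :=
    fun hg => FunctionSpaces.Torus.continuous_uncurry_of_continuous_stLift hg.continuous
  have hbd : ∀ {η : ℝ → ℝ} {κ : UnitAddTorus d → ℝ}, Continuous η → HasCompactSupport η → Continuous κ →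
      ∃ C, ∀ j t x, |FunctionSpaces.Torus.stConv η κ (fun q => U q j) t x| ≤ C := by
    intro η κ hη hηc hκ
    have h : ∀ j, ∃ C, ∀ t x, |FunctionSpaces.Torus.stConv η κ (fun q => U q j) t x| ≤ C := fun j =>
      exists_abs_stConv_le (hU1 j) hη hηc hκ
    choose C hC using h
    refine ⟨∑ j, |C j|, fun j t x => ((hC j t x).trans (le_abs_self _)).trans ?_⟩
    exact Finset.single_le_sum (f := fun j => |C j|) (fun j _ => abs_nonneg _) (Finset.mem_univ j)
  obtain ⟨Cw, hCw⟩ := hbd hρs.continuous hρc hks.continuous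
  obtain ⟨Cw', hCw'⟩ := hbd (hρ's.continuous) hρ'c hks.continuous
  obtain ⟨Cv, hCv⟩ := hbd hρs.continuous hρc hk's.continuous
  obtain ⟨Cv', hCv'⟩ := hbd (hρ's.continuous) hρ'c hk's.continuous
  -- time derivatives
  have hdw : ∀ j t x, HasDerivAt (fun τ => w j τ x) (w' j t x) t := fun j t x =>
    hasDerivAt_stConv_time (hU1 j) hρ1 hρc hk1 t x
  have hdv : ∀ j t x, HasDerivAt (fun τ => v j τ x) (v' j t x) t := fun j t x =>
    hasDerivAt_stConv_time (hU1 j) hρ1 hρc hk'1 t x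
  -- the key identity `(w s) ⋆ K = v s`, `(w' s) ⋆ K = v' s`
  have hwK : ∀ j s x, ((w j s) ⋆ K) x = v j s x := fun j s x =>
    convolution_stConv_apply (hU1 j) hρs.continuous hρc hks.continuous hK.continuous s x
  have hw'K : ∀ j s x, ((w' j s) ⋆ K) x = v' j s x := fun j s x =>
    convolution_stConv_apply (hU1 j) hρ's.continuous hρ'c hks.continuous hK.continuous s x
  -- the cut-off
  obtain ⟨⟨hψc, T', hT', hψT'⟩, ε₀, hε₀, hψε₀⟩ := hψ
  have hψcont : Continuous (uncurry ψ) := hcont hψc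
  have hψ'c : ContDiff ℝ ∞ (FunctionSpaces.Torus.stLift (FunctionSpaces.Torus.timeDeriv ψ)) := contDiff_stLift_timeDeriv' hψc
  have hψ'cont : Continuous (uncurry (FunctionSpaces.Torus.timeDeriv ψ)) := hcont hψ'c
  have hψab : ∀ t, t ∉ Icc ε₀ T' → ψ t = 0 := fun t ht => by
    rw [mem_Icc, not_and_or, not_le, not_le] at ht
    rcases ht with h | h
    · exact hψε₀ t h.le
    · exact hψT' t h.le
  have hψ'zero : ∀ t, (t ≤ ε₀ ∨ T' ≤ t) → ∀ x, FunctionSpaces.Torus.timeDeriv ψ t x = 0 := fun t ht x =>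
    timeDeriv_eq_zero_of_support hψc hψε₀ hψT' ht x
  have hψ'ab : ∀ t, t ∉ Icc ε₀ T' → ∀ x, FunctionSpaces.Torus.timeDeriv ψ t x = 0 := fun t ht x => by
    rw [mem_Icc, not_and_or, not_le, not_le] at ht
    rcases ht with h | h
    · exact hψ'zero t (Or.inl h.le) x
    · exact hψ'zero t (Or.inr h.le) x
  -- bounds for `ψ`, `∂ₜψ` (continuous, vanishing off the compact `[ε₀, T'] × T^d`)
  have hbdψ : ∀ {g : ℝ → UnitAddTorus d → ℝ}, Continuous (uncurry g) → (∀ t, t ∉ Icc ε₀ T' → ∀ x, g t x = 0) →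
      ∃ C, ∀ t x, |g t x| ≤ C := by
    intro g hg hg0
    obtain ⟨C₀, hC₀⟩ := (isCompact_Icc.prod isCompact_univ).exists_bound_of_continuousOn
      (s := Icc ε₀ T' ×ˢ (univ : Set (UnitAddTorus d))) hg.continuousOn
    refine ⟨max C₀ 0, fun t x => ?_⟩
    by_cases ht : t ∈ Icc ε₀ T'
    · have h := hC₀ (t, x) ⟨ht, mem_univ _⟩
      rw [Real.norm_eq_abs] at h
      exact h.trans (le_max_left _ _)
    · rw [hg0 t ht x]; simp
  obtain ⟨Cψ, hCψ⟩ := hbdψ hψcont (fun t ht x => by rw [hψab t ht]; rfl)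
  obtain ⟨Cψ', hCψ'⟩ := hbdψ hψ'cont hψ'ab
  -- the inner fields `G j` and the test field
  set G : d → ℝ × UnitAddTorus d → ℝ := fun j q =>
    symmTestField K (ψ q.1) (drVelocityApprox T u ρ k q.1) q.2 j with hG
  have hGeq : ∀ j q, G j q = ψ q.1 q.2 * v j q.1 q.2 + ((fun z => ψ q.1 z * w j q.1 z) ⋆ K) q.2 := by
    intro j q
    rw [hG]
    simp only []
    rw [symmTestField_apply_apply]
    have e1 : (fun z => drVelocityApprox T u ρ k q.1 z j) = w j q.1 := funext fun z => hwvel q.1 z j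
    have e2 : (fun z => ψ q.1 z * drVelocityApprox T u ρ k q.1 z j) = fun z => ψ q.1 z * w j q.1 z :=
      funext fun z => by rw [hwvel]
    rw [e1, e2, hwK]
  have hwC : ∀ t x j, |drVelocityApprox T u ρ k t x j| ≤ Cw := fun t x j => by rw [hwvel]; exact hCw j t x
  have hwcont : ∀ j, Continuous (uncurry fun t x => drVelocityApprox T u ρ k t x j) := fun j => by
    have : (uncurry fun t x => drVelocityApprox T u ρ k t x j) = uncurry (w j) := by
      funext q; exact hwvel q.1 q.2 j
    rw [this]; exact hcont (hw_s j)
  have hGi : ∀ j, Integrable (G j) μ := fun j =>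
    integrable_symmTestField_inner hwC hwcont hK.continuous hψcont hCψ hψab j
  have hΦdef : drTestApprox T u ρ k K ψ = vecField fun j => FunctionSpaces.Torus.stConv ρ k (G j) := rfl
  -- Step A: the left-hand side on `ℝ × T^d`
  have hΦ'j : ∀ j t x, FunctionSpaces.Torus.timeDeriv (drTestApprox T u ρ k K ψ) t x j =
      FunctionSpaces.Torus.stConv (deriv ρ) k (G j) t x := by
    intro j t x
    rw [hΦdef, timeDeriv_vecField_apply (fun i => ?_) j, FunctionSpaces.Torus.timeDeriv_stConv (hGi j) hρ1 hρc hk1]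
    exact (hasDerivAt_stConv_time (hGi i) hρ1 hρc hk1 t x).differentiableAt
  have hinner : ∀ (a : EuclideanSpace ℝ d) t x, ⟪a, FunctionSpaces.Torus.timeDeriv (drTestApprox T u ρ k K ψ) t x⟫_ℝ =
      ∑ j, a j * FunctionSpaces.Torus.stConv (deriv ρ) k (G j) t x := by
    intro a t x
    rw [PiLp.inner_apply]
    refine Finset.sum_congr rfl fun j _ => ?_
    rw [hΦ'j j t x]
    simp [mul_comm]
  -- bounds and integrability of `U_j · stConv ρ' k G_j`
  have hD : ∀ j, ∃ C, ∀ t x, |FunctionSpaces.Torus.stConv (deriv ρ) k (G j) t x| ≤ C := fun j =>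
    exists_abs_stConv_le (hGi j) hρ's.continuous hρ'c hks.continuous
  choose CD hCD using hD
  have hDs : ∀ j, ContDiff ℝ ∞ (FunctionSpaces.Torus.stLift (FunctionSpaces.Torus.stConv (deriv ρ) k (G j))) := fun j =>
    FunctionSpaces.Torus.contDiff_top_stLift_stConv (hGi j) hρ's hρ'c hks
  have hIUD : ∀ j, Integrable (fun q : ℝ × UnitAddTorus d => U q j * FunctionSpaces.Torus.stConv (deriv ρ) k (G j) q.1 q.2) μ :=
    fun j => (hU1 j).mul_bdd (hcont (hDs j)).aestronglyMeasurable (ae_of_all _ fun q => by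
      rw [Real.norm_eq_abs]; exact hCD j q.1 q.2)
  have hLHS : ∫ t in Ioo 0 T, ∫ x, ⟪u t x, FunctionSpaces.Torus.timeDeriv (drTestApprox T u ρ k K ψ) t x⟫_ℝ =
      ∑ j, ∫ q, U q j * FunctionSpaces.Torus.stConv (deriv ρ) k (G j) q.1 q.2 ∂μ := by
    -- `∫_μ ∑ⱼ Uⱼ Dⱼ = ∑ⱼ ∫_μ Uⱼ Dⱼ`, and the integrand vanishes off `(0,T)`
    rw [← integral_finsetSum _ fun j _ => hIUD j]
    have hsum_i : Integrable (fun q : ℝ × UnitAddTorus d => ∑ j, U q j * FunctionSpaces.Torus.stConv (deriv ρ) k (G j) q.1 q.2) μ :=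
      integrable_finsetSum _ fun j _ => hIUD j
    rw [show (fun a : ℝ × UnitAddTorus d => ∑ j ∈ Finset.univ, U a j * FunctionSpaces.Torus.stConv (deriv ρ) k (G j) a.1 a.2) =
      fun q => ∑ j, U q j * FunctionSpaces.Torus.stConv (deriv ρ) k (G j) q.1 q.2 from rfl]
    rw [integral_prod _ hsum_i]
    -- slices: `t ∈ (0,T)` gives the pairing with `u`, otherwise `0`
    have hslice : ∀ t, ∫ x, ∑ j, U (t, x) j * FunctionSpaces.Torus.stConv (deriv ρ) k (G j) t x =
        (Ioo 0 T).indicator (fun t => ∫ x, ⟪u t x, FunctionSpaces.Torus.timeDeriv (drTestApprox T u ρ k K ψ) t x⟫_ℝ) t := by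
      intro t
      by_cases ht : t ∈ Ioo 0 T
      · rw [indicator_of_mem ht]
        refine integral_congr_ae (ae_of_all _ fun x => ?_)
        show ∑ j, U (t, x) j * FunctionSpaces.Torus.stConv (deriv ρ) k (G j) t x =
          ⟪u t x, FunctionSpaces.Torus.timeDeriv (drTestApprox T u ρ k K ψ) t x⟫_ℝ
        rw [hinner]
        refine Finset.sum_congr rfl fun j _ => ?_
        rw [hU, stBar_apply_of_mem ht]
      · rw [indicator_of_notMem ht]
        refine (integral_congr_ae (ae_of_all _ fun x => ?_)).trans (integral_zero _ _)
        show ∑ j, U (t, x) j * FunctionSpaces.Torus.stConv (deriv ρ) k (G j) t x = 0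
        refine Finset.sum_eq_zero fun j _ => ?_
        rw [hU, stBar_apply_of_not_mem ht]
        simp
    simp_rw [hslice]
    rw [integral_indicator measurableSet_Ioo]
  -- Step B: duality with the odd kernel, componentwise: `∫ Uⱼ (stConv ρ' k Gⱼ) = -∫ Gⱼ w'ⱼ`
  have hB : ∀ j, ∫ q, U q j * FunctionSpaces.Torus.stConv (deriv ρ) k (G j) q.1 q.2 ∂μ =
      -∫ p, G j p * w' j p.1 p.2 ∂μ := fun j =>
    integral_mul_stConv_odd_even (hU1 j) (hGi j) (hρ's.continuous) hρ'c hρ'odd hks.continuous hkev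
  -- Step C: `∫ Gⱼ w'ⱼ = ∫ ψ (vⱼ w'ⱼ + wⱼ v'ⱼ)`
  have hIab : ∀ {f : ℝ × UnitAddTorus d → ℝ}, AEStronglyMeasurable f μ → (∃ M, ∀ q, ‖f q‖ ≤ M) →
      (∀ q : ℝ × UnitAddTorus d, q.1 ∉ Icc ε₀ T' → f q = 0) → Integrable f μ :=
    fun hf ⟨M, hM⟩ h0 => integrable_of_bdd_of_time_support hf hM h0
  have hC : ∀ j, ∫ p, G j p * w' j p.1 p.2 ∂μ =
      ∫ p, ψ p.1 p.2 * (v j p.1 p.2 * w' j p.1 p.2 + w j p.1 p.2 * v' j p.1 p.2) ∂μ := by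
    intro j
    -- the two pieces of `Gⱼ w'ⱼ`
    have hP1 : Integrable (fun p : ℝ × UnitAddTorus d => ψ p.1 p.2 * v j p.1 p.2 * w' j p.1 p.2) μ := by
      refine hIab ((hψcont.aestronglyMeasurable.mul (hcont (hv_s j)).aestronglyMeasurable).mul
        (hcont (hw'_s j)).aestronglyMeasurable) ⟨Cψ * Cv * Cw', fun q => ?_⟩ (fun q hq => by rw [hψab q.1 hq]; simp)
      rw [Real.norm_eq_abs, abs_mul, abs_mul]
      have h0ψ : 0 ≤ Cψ := (abs_nonneg _).trans (hCψ q.1 q.2)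
      exact mul_le_mul (mul_le_mul (hCψ _ _) (hCv j _ _) (abs_nonneg _) h0ψ) (hCw' j _ _) (abs_nonneg _)
        (mul_nonneg h0ψ ((abs_nonneg _).trans (hCv j q.1 q.2)))
    obtain ⟨hb2, hm2⟩ := bound_and_measurable_sliceConv (w := fun t x => ψ t x * w j t x) (C := Cψ * Cw)
      (fun t x => by rw [abs_mul]; exact mul_le_mul (hCψ t x) (hCw j t x) (abs_nonneg _) ((abs_nonneg _).trans (hCψ t x)))
      (hψcont.mul (hcont (hw_s j))) hK.continuous
    have hP2 : Integrable (fun p : ℝ × UnitAddTorus d => ((fun z => ψ p.1 z * w j p.1 z) ⋆ K) p.2 * w' j p.1 p.2) μ := by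
      refine hIab (hm2.mul (hcont (hw'_s j)).aestronglyMeasurable) ⟨Cψ * Cw * (∫ y, ‖K y‖) * Cw', fun q => ?_⟩
        (fun q hq => ?_)
      · rw [Real.norm_eq_abs, abs_mul]
        exact mul_le_mul (hb2 q.1 q.2) (hCw' j _ _) (abs_nonneg _)
          ((abs_nonneg _).trans (hb2 q.1 q.2))
      · have e : (fun z => ψ q.1 z * w j q.1 z) = 0 := by funext z; rw [hψab q.1 hq]; simp
        rw [e, zero_convolution]; simp
    have hP3 : Integrable (fun p : ℝ × UnitAddTorus d => ψ p.1 p.2 * w j p.1 p.2 * v' j p.1 p.2) μ := by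
      refine hIab ((hψcont.aestronglyMeasurable.mul (hcont (hw_s j)).aestronglyMeasurable).mul
        (hcont (hv'_s j)).aestronglyMeasurable) ⟨Cψ * Cw * Cv', fun q => ?_⟩ (fun q hq => by rw [hψab q.1 hq]; simp)
      rw [Real.norm_eq_abs, abs_mul, abs_mul]
      have h0ψ : 0 ≤ Cψ := (abs_nonneg _).trans (hCψ q.1 q.2)
      exact mul_le_mul (mul_le_mul (hCψ _ _) (hCw j _ _) (abs_nonneg _) h0ψ) (hCv' j _ _) (abs_nonneg _)
        (mul_nonneg h0ψ ((abs_nonneg _).trans (hCw j q.1 q.2)))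
    -- expand `Gⱼ`
    have e1 : ∫ p, G j p * w' j p.1 p.2 ∂μ = (∫ p, ψ p.1 p.2 * v j p.1 p.2 * w' j p.1 p.2 ∂μ) +
        ∫ p, ((fun z => ψ p.1 z * w j p.1 z) ⋆ K) p.2 * w' j p.1 p.2 ∂μ := by
      rw [← integral_add hP1 hP2]
      refine integral_congr_ae (ae_of_all _ fun p => ?_)
      show G j p * w' j p.1 p.2 = _
      rw [hGeq]; ring
    -- adjointness in the space variable, slice by slice
    have e2 : ∫ p, ((fun z => ψ p.1 z * w j p.1 z) ⋆ K) p.2 * w' j p.1 p.2 ∂μ =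
        ∫ p, ψ p.1 p.2 * w j p.1 p.2 * v' j p.1 p.2 ∂μ := by
      rw [integral_prod _ hP2, integral_prod _ hP3]
      refine integral_congr_ae (ae_of_all _ fun s => ?_)
      have hf : Integrable (fun z => ψ s z * w j s z) volume :=
        ((hψcont.mul (hcont (hw_s j))).comp (Continuous.prodMk_right s)).integrable_unitAddTorus
      have hg : Integrable (w' j s) volume := ((hcont (hw'_s j)).comp (Continuous.prodMk_right s)).integrable_unitAddTorus
      have h := FunctionSpaces.Torus.integral_mul_convolution_comm hf hg hK.continuous hKev
      -- `∫ (ψw ⋆ K) w' = ∫ ψw (w' ⋆ K) = ∫ ψw v'`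
      show ∫ y, ((fun z => ψ s z * w j s z) ⋆ K) y * w' j s y = ∫ y, ψ s y * w j s y * v' j s y
      rw [← h]
      refine integral_congr_ae (ae_of_all _ fun y => ?_)
      show ψ s y * w j s y * ((w' j s) ⋆ K) y = ψ s y * w j s y * v' j s y
      rw [hw'K]
    rw [e1, e2, ← integral_add hP1 hP3]
    refine integral_congr_ae (ae_of_all _ fun p => ?_)
    ring
  -- Step D: sum over components and integrate by parts in time
  set h : ℝ × UnitAddTorus d → ℝ := fun q => ∑ j, w j q.1 q.2 * v j q.1 q.2 with hh
  set h' : ℝ × UnitAddTorus d → ℝ := fun q => ∑ j, (v j q.1 q.2 * w' j q.1 q.2 + w j q.1 q.2 * v' j q.1 q.2) with hh'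
  have hdh : ∀ x s, HasDerivAt (fun τ => h (τ, x)) (h' (s, x)) s := by
    intro x s
    simp only [hh, hh']
    refine HasDerivAt.fun_sum fun j _ => ?_
    have h1 := (hdw j s x).fun_mul (hdv j s x)
    exact h1.congr_deriv (by ring)
  have hh_cont : Continuous h := continuous_finsetSum _ fun j _ => (hcont (hw_s j)).mul (hcont (hv_s j))
  have hh'_cont : Continuous h' := continuous_finsetSum _ fun j _ =>
    ((hcont (hv_s j)).mul (hcont (hw'_s j))).add ((hcont (hw_s j)).mul (hcont (hv'_s j)))
  obtain ⟨Ch, hCh⟩ : ∃ C, ∀ q, |h q| ≤ C := by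
    refine ⟨∑ j : d, Cw * Cv, fun q => (Finset.abs_sum_le_sum_abs _ _).trans (Finset.sum_le_sum fun j _ => ?_)⟩
    rw [abs_mul]
    exact mul_le_mul (hCw j _ _) (hCv j _ _) (abs_nonneg _) ((abs_nonneg _).trans (hCw j q.1 q.2))
  obtain ⟨Ch', hCh'⟩ : ∃ C, ∀ q, |h' q| ≤ C := by
    refine ⟨∑ j : d, (Cv * Cw' + Cw * Cv'), fun q => (Finset.abs_sum_le_sum_abs _ _).trans (Finset.sum_le_sum fun j _ => ?_)⟩
    refine (abs_add_le _ _).trans (add_le_add ?_ ?_)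
    · rw [abs_mul]; exact mul_le_mul (hCv j _ _) (hCw' j _ _) (abs_nonneg _) ((abs_nonneg _).trans (hCv j q.1 q.2))
    · rw [abs_mul]; exact mul_le_mul (hCw j _ _) (hCv' j _ _) (abs_nonneg _) ((abs_nonneg _).trans (hCw j q.1 q.2))
  have hIψh' : Integrable (fun q : ℝ × UnitAddTorus d => ψ q.1 q.2 * h' q) μ := by
    refine hIab (hψcont.aestronglyMeasurable.mul hh'_cont.aestronglyMeasurable) ⟨Cψ * Ch', fun q => ?_⟩
      (fun q hq => by rw [hψab q.1 hq]; simp)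
    rw [Real.norm_eq_abs, abs_mul]
    exact mul_le_mul (hCψ _ _) (hCh' _) (abs_nonneg _) ((abs_nonneg _).trans (hCψ q.1 q.2))
  have hIψ'h : Integrable (fun q : ℝ × UnitAddTorus d => FunctionSpaces.Torus.timeDeriv ψ q.1 q.2 * h q) μ := by
    refine hIab (hψ'cont.aestronglyMeasurable.mul hh_cont.aestronglyMeasurable) ⟨Cψ' * Ch, fun q => ?_⟩
      (fun q hq => by rw [hψ'ab q.1 hq q.2]; simp)
    rw [Real.norm_eq_abs, abs_mul]
    exact mul_le_mul (hCψ' _ _) (hCh _) (abs_nonneg _) ((abs_nonneg _).trans (hCψ' q.1 q.2))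
  have hD : ∑ j, ∫ p, ψ p.1 p.2 * (v j p.1 p.2 * w' j p.1 p.2 + w j p.1 p.2 * v' j p.1 p.2) ∂μ =
      -∫ q, FunctionSpaces.Torus.timeDeriv ψ q.1 q.2 * h q ∂μ := by
    -- `∑ⱼ ∫ ψ (…) = ∫ ψ h'`
    have hIj : ∀ j, Integrable (fun p : ℝ × UnitAddTorus d =>
        ψ p.1 p.2 * (v j p.1 p.2 * w' j p.1 p.2 + w j p.1 p.2 * v' j p.1 p.2)) μ := by
      intro j
      refine hIab ((hψcont.aestronglyMeasurable).mul ((((hcont (hv_s j)).mul (hcont (hw'_s j))).add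
        ((hcont (hw_s j)).mul (hcont (hv'_s j)))).aestronglyMeasurable)) ⟨Cψ * (Cv * Cw' + Cw * Cv'), fun q => ?_⟩
        (fun q hq => by rw [hψab q.1 hq]; simp)
      rw [Real.norm_eq_abs, abs_mul]
      refine mul_le_mul (hCψ _ _) ((abs_add_le _ _).trans (add_le_add ?_ ?_)) (abs_nonneg _)
        ((abs_nonneg _).trans (hCψ q.1 q.2))
      · rw [abs_mul]; exact mul_le_mul (hCv j _ _) (hCw' j _ _) (abs_nonneg _) ((abs_nonneg _).trans (hCv j q.1 q.2))
      · rw [abs_mul]; exact mul_le_mul (hCw j _ _) (hCv' j _ _) (abs_nonneg _) ((abs_nonneg _).trans (hCw j q.1 q.2))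
    rw [← integral_finsetSum _ fun j _ => hIj j]
    have e : (fun a : ℝ × UnitAddTorus d => ∑ j ∈ Finset.univ, ψ a.1 a.2 * (v j a.1 a.2 * w' j a.1 a.2 + w j a.1 a.2 * v' j a.1 a.2)) =
        fun q => ψ q.1 q.2 * h' q := by
      funext q; simp only [hh', Finset.mul_sum]
    rw [e]
    -- Fubini with `x` outside, then integration by parts in `s` for every `x`
    rw [integral_prod_symm _ hIψh', integral_prod_symm _ hIψ'h, ← integral_neg]
    refine integral_congr_ae (ae_of_all _ fun x => ?_)
    show ∫ s, ψ s x * h' (s, x) = -∫ s, FunctionSpaces.Torus.timeDeriv ψ s x * h (s, x)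
    -- one-dimensional integration by parts on `ℝ`, `s ↦ ψ s x` compactly supported
    have hsuppψ : ∀ s, s ∉ Icc ε₀ T' → ψ s x = 0 := fun s hs => by rw [hψab s hs]; rfl
    have hcs : HasCompactSupport fun s => ψ s x :=
      HasCompactSupport.of_support_subset_isCompact (isCompact_Icc : IsCompact (Icc ε₀ T')) (fun s hs => by
        by_contra h; exact hs (hsuppψ s h))
    have hcs' : HasCompactSupport fun s => FunctionSpaces.Torus.timeDeriv ψ s x :=
      HasCompactSupport.of_support_subset_isCompact (isCompact_Icc : IsCompact (Icc ε₀ T')) (fun s hs => by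
        by_contra h; exact hs (hψ'ab s h x))
    have hψx : ∀ s, HasDerivAt (fun τ => ψ τ x) (FunctionSpaces.Torus.timeDeriv ψ s x) s := fun s =>
      (differentiableAt_time_slice' hψc s x).hasDerivAt
    have hcψx : Continuous fun s => ψ s x := hψcont.comp (Continuous.prodMk_left x)
    have hcψ'x : Continuous fun s => FunctionSpaces.Torus.timeDeriv ψ s x := hψ'cont.comp (Continuous.prodMk_left x)
    have hchx : Continuous fun s => h (s, x) := hh_cont.comp (Continuous.prodMk_left x)
    have hch'x : Continuous fun s => h' (s, x) := hh'_cont.comp (Continuous.prodMk_left x)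
    have key := integral_mul_deriv_eq_deriv_mul_of_integrable (u := fun s => ψ s x) (v := fun s => h (s, x))
      (u' := fun s => FunctionSpaces.Torus.timeDeriv ψ s x) (v' := fun s => h' (s, x))
      (fun s _ => hψx s) (fun s _ => hdh x s)
      ((hcψx.mul hch'x).integrable_of_hasCompactSupport hcs.mul_right)
      ((hcψ'x.mul hchx).integrable_of_hasCompactSupport hcs'.mul_right)
      ((hcψx.mul hchx).integrable_of_hasCompactSupport hcs.mul_right)
    simpa using key
  -- Step E: the right-hand side
  have hRHS : ∫ t in Ioo 0 T, ∫ x, ⟪drVelocityApprox T u ρ k t x, vecConv (drVelocityApprox T u ρ k t) K x⟫_ℝ *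
      FunctionSpaces.Torus.timeDeriv ψ t x = ∫ q, FunctionSpaces.Torus.timeDeriv ψ q.1 q.2 * h q ∂μ := by
    have hpt : ∀ t x, ⟪drVelocityApprox T u ρ k t x, vecConv (drVelocityApprox T u ρ k t) K x⟫_ℝ *
        FunctionSpaces.Torus.timeDeriv ψ t x = FunctionSpaces.Torus.timeDeriv ψ t x * h (t, x) := by
      intro t x
      rw [PiLp.inner_apply, mul_comm]
      congr 1
      simp only [hh]
      refine Finset.sum_congr rfl fun j _ => ?_
      rw [vecConv_apply, hwvel]
      have e1 : (fun y => drVelocityApprox T u ρ k t y j) = w j t := funext fun y => hwvel t y j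
      rw [e1, hwK]
      simp [mul_comm]
    simp_rw [hpt]
    rw [integral_prod _ hIψ'h]
    -- the `t`-integrand vanishes off `(0, T)`
    refine (setIntegral_eq_integral_of_forall_compl_eq_zero fun t ht => ?_).trans rfl
    have ht' : t ≤ ε₀ ∨ T' ≤ t := by
      rw [mem_Ioo, not_and_or, not_lt, not_lt] at ht
      rcases ht with h | h
      · exact Or.inl (h.trans hε₀.le)
      · exact Or.inr (hT'.le.trans h)
    refine (integral_congr_ae (ae_of_all _ fun x => ?_)).trans (integral_zero _ _)
    show FunctionSpaces.Torus.timeDeriv ψ t x * h (t, x) = 0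
    rw [hψ'zero t ht' x, zero_mul]
  -- assemble
  rw [hLHS, hRHS]
  simp_rw [hB, hC]
  rw [Finset.sum_neg_distrib, hD, neg_neg]

end Pairing

end Literature.Analysis.FluidPDE.Torus
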